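import Literature.Analysis.ODE.GlobalExistence
import HarnessLib

/-!
# Two-sided global existence for autonomous ODEs from a priori bounds

Topic `Literature/Analysis/ODE`. A corollary of the tree's forward continuation principle
`Literature.Analysis.ODE.exists_solution_of_apriori_bound` (Teschl 2012, Cor. 2.16; Hale 1980,
Ch. I Thm. 2.1): for an **autonomous** field `f : E → E` that is Lipschitz on every ball, if the
solutions of BOTH `x' = f(x)` and the time-reversed equation `x' = -f(x)` issued from `x₀` obey an
a priori bound on every finite horizon, then `x' = f(x)` has a solution `α : ℝ → E` defined on the
whole real line with `α 0 = x₀` and `HasDerivAt α (f (α t)) t` for every `t` (forward solution,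
time-reversed forward solution of the reversed field, glued at `t = 0`; the gluing is the one of
`Literature.Analysis.ODE.exists_solution_of_linearGrowth`). The two equations are written
uniformly as `x' = c • f(x)` with `|c| = 1`, which is the form in which conserved-quantity
(energy) bounds are usually available (they are insensitive to the sign of time).

Used by `Literature/MathematicalPhysics/KineticTheory/InfiniteChainDynamicsProofs.lean`
(global existence of the severed Hamiltonian dynamics of an oscillator chain, Lanford–Lebowitz–Lieb
1977, condition B1).

## References

* G. Teschl, *Ordinary Differential Equations and Dynamical Systems*, GSM 140 (AMS 2012),
  Cor. 2.16. [Teschl2012]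
* J. K. Hale, *Ordinary Differential Equations*, 2nd ed. (Krieger 1980), Ch. I, Thm. 2.1.
-/

noncomputable section

open Set Metric Filter Topology

open scoped NNReal

namespace Literature.Analysis.ODE

variable {E : Type*} [NormedAddCommGroup E] [NormedSpace ℝ E] [CompleteSpace E]

/-- **Two-sided global existence from a priori bounds (autonomous field).** Let `f : E → E`
(Banach `E`) be Lipschitz on every ball `‖x‖ ≤ ρ`, and suppose that for `c = 1` and `c = -1`
(written `|c| = 1`) and every horizon `T ≥ 0` there is `R ≥ ‖x₀‖` such that every solution of
`α' = c • f(α)`, `α 0 = x₀`, on any `[0, s] ⊆ [0, T]` satisfies `‖α t‖ ≤ R` on `[0, s]`. Then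
there is `α : ℝ → E` with `α 0 = x₀` and `α' (t) = f (α t)` for all `t ∈ ℝ`
(Teschl 2012, Cor. 2.16, applied forward to `f` and to the reversed field `-f`, the two half-line
solutions glued at `0`). [cite: Teschl2012, Cor. 2.16] -/
theorem exists_solution_real_of_apriori_bound {f : E → E} {x₀ : E}
    (hlip : ∀ ρ : ℝ, ∃ K : ℝ≥0, LipschitzOnWith K f (closedBall 0 ρ))
    (hapriori : ∀ c : ℝ, |c| = 1 → ∀ T : ℝ, 0 ≤ T → ∃ R : ℝ, ‖x₀‖ ≤ R ∧ ∀ s ∈ Icc 0 T,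
      ∀ α : ℝ → E, α 0 = x₀ →
        (∀ t ∈ Icc 0 s, HasDerivWithinAt α (c • f (α t)) (Icc 0 s) t) →
          ∀ t ∈ Icc 0 s, ‖α t‖ ≤ R) :
    ∃ α : ℝ → E, α 0 = x₀ ∧ ∀ t, HasDerivAt α (f (α t)) t := by
  -- forward solution
  obtain ⟨α, hα0, hα⟩ := exists_solution_of_apriori_bound (v := fun _ x => f x) (x₀ := x₀)
    (fun _ ρ => (hlip ρ).imp fun K hK _ _ => hK) (fun _ => continuousOn_const)
    (fun T hT => by
      obtain ⟨R, hR0, hR⟩ := hapriori 1 (by simp) T hT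
      exact ⟨R, hR0, fun s hs β hβ0 hβ => hR s hs β hβ0 fun t ht => by simpa using hβ t ht⟩)
  -- backward solution, as a forward solution of the reversed field `-f`
  obtain ⟨β, hβ0, hβ⟩ := exists_solution_of_apriori_bound (v := fun _ x => -f x) (x₀ := x₀)
    (fun _ ρ => (hlip ρ).imp fun K hK _ _ => hK.neg) (fun _ => continuousOn_const)
    (fun T hT => by
      obtain ⟨R, hR0, hR⟩ := hapriori (-1) (by simp) T hT
      exact ⟨R, hR0, fun s hs β hβ0 hβ => hR s hs β hβ0 fun t ht => by simpa using hβ t ht⟩)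
  refine ⟨fun t => if 0 ≤ t then α t else β (-t), by simp [hα0], fun t => ?_⟩
  rcases lt_trichotomy 0 t with ht | rfl | ht
  · -- `t > 0`
    have h1 : HasDerivAt α (f (α t)) t :=
      (hα (t + 1) t ⟨ht.le, by linarith⟩).hasDerivAt (Icc_mem_nhds ht (by linarith))
    have heq : (fun s => if 0 ≤ s then α s else β (-s)) =ᶠ[𝓝 t] α := by
      filter_upwards [Ioi_mem_nhds ht] with s hs
      exact if_pos (le_of_lt hs)
    rw [show (fun s => if 0 ≤ s then α s else β (-s)) t = α t from if_pos ht.le]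
    exact h1.congr_of_eventuallyEq heq
  · -- `t = 0`: glue the one-sided derivatives
    have hr : HasDerivWithinAt (fun s => if 0 ≤ s then α s else β (-s)) (f x₀) (Ici 0) 0 := by
      have h1 : HasDerivWithinAt α (f (α 0)) (Ici 0) 0 :=
        (hα 1 0 ⟨le_rfl, zero_le_one⟩).mono_of_mem_nhdsWithin (Icc_mem_nhdsGE zero_lt_one)
      rw [hα0] at h1
      exact h1.congr (fun s hs => if_pos hs) (by simp)
    have hl : HasDerivWithinAt (fun s => if 0 ≤ s then α s else β (-s)) (f x₀) (Iic 0) 0 := by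
      have h1 : HasDerivWithinAt β (-f (β 0)) (Ici 0) 0 :=
        (hβ 1 0 ⟨le_rfl, zero_le_one⟩).mono_of_mem_nhdsWithin (Icc_mem_nhdsGE zero_lt_one)
      have h2 : HasDerivWithinAt (β ∘ Neg.neg) ((-1 : ℝ) • (-f (β 0))) (Iic 0) 0 := by
        refine HasDerivWithinAt.scomp (0 : ℝ) (by simpa using h1)
          ((hasDerivAt_neg (0 : ℝ)).hasDerivWithinAt) fun s hs => ?_
        simpa using hs
      have h3 : (-1 : ℝ) • (-f (β 0)) = f x₀ := by simp [hβ0]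
      rw [h3] at h2
      refine h2.congr (fun s hs => ?_) (by simp [hα0, hβ0])
      rcases eq_or_lt_of_le (show s ≤ 0 from hs) with h | h
      · simp [h, hα0, hβ0]
      · simp [not_le.2 h]
    have := hl.union hr
    rw [Iic_union_Ici, hasDerivWithinAt_univ] at this
    simpa [hα0] using this
  · -- `t < 0`
    have hnt : (0 : ℝ) < -t := by linarith
    have h1 : HasDerivAt β (-f (β (-t))) (-t) :=
      (hβ (-t + 1) (-t) ⟨hnt.le, by linarith⟩).hasDerivAt (Icc_mem_nhds hnt (by linarith))
    have h2 : HasDerivAt (β ∘ Neg.neg) ((-1 : ℝ) • (-f (β (-t)))) t :=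
      HasDerivAt.scomp t h1 (hasDerivAt_neg t)
    have h3 : (-1 : ℝ) • (-f (β (-t))) = f (β (-t)) := by simp
    rw [h3] at h2
    have heq : (fun s => if 0 ≤ s then α s else β (-s)) =ᶠ[𝓝 t] (β ∘ Neg.neg) := by
      filter_upwards [Iio_mem_nhds ht] with s (hs : s < 0)
      simp only [if_neg (not_le.2 hs), Function.comp_apply]
    rw [show (fun s => if 0 ≤ s then α s else β (-s)) t = β (-t) from if_neg (not_le.2 ht)]
    exact h2.congr_of_eventuallyEq heq

end Literature.Analysis.ODE

end
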